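import Summits.QuantumFields.YangMills.Theorems.AllWindowsColdBoxBoxHighLineSmearedFPOperator
import Summits.QuantumFields.YangMills.Theorems.AllWindowsColdBoxBoxHighLineSmearedFPPauli
import Summits.QuantumFields.YangMills.Theorems.AllWindowsColdBoxBoxHighLineSmearedFPOrbit

/-!
# T-S5.4J DEFS — `jacWeight`, `laplaceZ0`, `orbitMapFlat` and the six Props `OrbitNormaliserJacobian` (target), J1 `OrbitMapJacobianDet`,
# J2 `OrbitMapContraction`, J4 `OrbitMapBulkSurj`, BYTE-FOR-BYTE from the planner's task file
# `Cruxes/BoxWindowHighSU2213/TaskS5Laplace.lean` (ym-idea-2 g18, commit ae884a356928), so that every brick owner (w3 J1, w2 J2, w4 J4) and the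
# builder (ym-line-fcl-p3 g25) refer to ONE declaration each.  The far-region bricks J5a/J5b are w5's `…PauliFarRegion.lean`
# (`FarRegionPhiLowerBall` with the `< 4r²` ball hypothesis, `FPOperatorDetCrude` in factorial form) and are NOT redeclared here.  (The definitional bridge `vecToField = ♭⁻¹` to 4k-C lives in the builder's assembly file.)

WHY THE JACOBIAN FORM (planner 18:11Z, recorded in the task file): S5 needs every correction RELATIVE to the `T⁻⁸` main term; the sup-box Laplace
sandwich of STEP1c gives `R_* ≍ H⁻⁶ log⁴`, the Jacobian-weighted weight `h_J = fpWeight·|det fpOperator|` turns the orbit integral into an exact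
Gaussian in the divergence coordinates `c = Ψ_V(A)` and gives `|N_J/Z₀ − 1| ≤ e^{−cH⁴}` in the window `C·H¹²(1+log β)⁸ ≤ β` (LINE-19; `U5-window` OPEN).

HONEST LABEL: task STATEMENTS (three defs + four Props, no proofs of the Props); T-S5.4J, S5 (LINE-19 ⟨stmt-QuantumFields-24004⟩/⟨24335⟩), U5
(LINE-20 ⟨24336⟩) and the three items are OPEN; route AllWindowsColdBox DRAFT; the Yang–Mills mass gap is NOT proved by this file; no summit is
proved by a line.
-/

set_option autoImplicit false

noncomputable section

open MeasureTheory Matrix Finset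
open Literature.MathematicalPhysics.QuantumFieldTheory.AxialGauge (boxEdges)
open Literature.MathematicalPhysics.QuantumFieldTheory.Balaban1983to89.B10Eq22Rescaling (sigmaSU2)
open Literature.MathematicalPhysics.QuantumLattice (gaugeTransformZd LGConfig)
open Literature.Probability.LatticeModels (Site)

namespace Summit.QuantumFields.YangMills.Theorems.AllWindowsColdBoxBoxHighLine

/-! ## The three objects -/

/-- **The Jacobian-weighted smeared gauge-fixing weight** `h_J(W) = exp(−β·Φ(W)) · χ_r(W) · |det F_FP(W)|` — ✓`fpWeight` times the absolute
Faddeev–Popov determinant of ✓`fpOperator` AT the configuration `W`.  Measurable, `≥ 0`, bounded (J5b), so ✓T-S5.1 applies to `h_J + ε`. -/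
def jacWeight (β : ℝ) (H : ℕ) (r : ℝ) (W : LGConfig 4 SU2) : ℝ :=
  fpWeight β H r W * |(fpOperator H W).det|

/-- **The Gaussian constant** `Z₀(β,H) = (2π²)^{−n'} · (π/β)^{3n'/2}`, `n' = #interiorSites H` (= `(2H−1)⁴` for `H ≥ 1`). -/
def laplaceZ0 (β : ℝ) (H : ℕ) : ℝ :=
  ((2 * Real.pi ^ 2)⁻¹) ^ (interiorSites H).card * (Real.pi / β) ^ ((3 : ℝ) * (interiorSites H).card / 2)

/-- **The orbit map in flat coordinates** `Ψ_V : ℝ^{I×3} → ℝ^{I×3}`, `v ↦ ((x,c) ↦ divDefect (V^{pauliGauge (♭⁻¹ v)}) x c)` — the gauge-fixing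
function along the interior gauge orbit of `V` in the Pauli exponential chart (`♭⁻¹ = vecToField`, ✓SmearedFPOperator). -/
def orbitMapFlat (H : ℕ) (V : LGConfig 4 SU2) (v : ↥(interiorSites H) × Fin 3 → ℝ) : ↥(interiorSites H) × Fin 3 → ℝ :=
  fun p => divDefect (gaugeTransformZd (pauliGauge H (vecToField H v)) V) (p.1 : Site 4) p.2

/-! ## The target -/

/-- **T-S5.4J `OrbitNormaliserJacobian` (M given J1–J5; builder fcl-p3).**  For `H ≥ 1`, `β ≥ 2` in the window `C·H¹²·(1+log β)⁸ ≤ β`,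
a base point `V` in lattice Landau gauge with cold-box links within defect `r₀²` of the identity (`C·r₀·H² ≤ 1`), and a cut-off radius `r`
with `r₀ + 1/(C·H⁴·(1+log β)²) ≤ r` and `C·r·H ≤ 1`: the orbit average of the Jacobian-weighted weight is the Gaussian constant up to an
EXPONENTIALLY small relative error, `|N_J(V)/Z₀ − 1| ≤ exp(−c·H⁴)`. -/
def OrbitNormaliserJacobian : Prop :=
  ∃ C c : ℝ, 0 < C ∧ 0 < c ∧ ∀ H : ℕ, 1 ≤ H → ∀ β r₀ r : ℝ, 2 ≤ β →
    C * (H : ℝ) ^ 12 * (1 + Real.log β) ^ 8 ≤ β →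
    0 ≤ r₀ → C * r₀ * (H : ℝ) ^ 2 ≤ 1 →
    r₀ + 1 / (C * (H : ℝ) ^ 4 * (1 + Real.log β) ^ 2) ≤ r → C * r * H ≤ 1 →
    ∀ V : LGConfig 4 SU2, InLandauGauge H V → (∀ e ∈ boxEdges 4 (2 * H + 1), linkDefect V e ≤ r₀ ^ 2) →
      |orbitAverage H (jacWeight β H r) V / laplaceZ0 β H - 1| ≤ Real.exp (-(c * (H : ℝ) ^ 4))

/-! ## The bricks -/

/-- **J1 `OrbitMapJacobianDet` (M; owner w3).**  The orbit map is differentiable everywhere and the absolute Jacobian determinant is the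
Faddeev–Popov determinant at the moved configuration times the Haar chart density: `|det DΨ_V(v)| = |det F(V^{pauliGauge A})| · Π_x 2π²σ(‖A_x‖)`,
`A = ♭⁻¹v`.  Route: `pauliGauge (A + tB) = k_t · pauliGauge A` with `k_t(x) = expPauli(A_x + tB_x)·expPauli(A_x)⁻¹`
(✓`extendGauge_mul`, ✓`gaugeTransformZd_gaugeTransformZd_eq` — the tree's action `g·U·g⁻¹` is a LEFT action), whose `t`-derivative at 0 is
`jac(−iA_x)(iB_x)` (✓`hasFDerivAt_expChart_right`); the derivative of `B' ↦ divDefect (W^{pauliGauge B'})` at `0` is `fpOperator H W` (w2's 4c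
analytic half, little-o form); chain rule; `|det ⊕_x jac(−iA_x)| = Π_x (sin‖A_x‖/‖A_x‖)²` (✓`det_jac_su2`, `Matrix.det_blockDiagonal`)
`= Π_x 2π²·sigmaSU2 ‖A_x‖` (✓`sigmaSU2_eq_sigma0_mul_det_jac`). -/
def OrbitMapJacobianDet : Prop :=
  ∀ (H : ℕ) (V : LGConfig 4 SU2) (v : ↥(interiorSites H) × Fin 3 → ℝ),
    DifferentiableAt ℝ (orbitMapFlat H V) v ∧
    |(fderiv ℝ (orbitMapFlat H V) v).det| =
      |(fpOperator H (gaugeTransformZd (pauliGauge H (vecToField H v)) V)).det| *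
        ∏ x : ↥(interiorSites H), (2 * Real.pi ^ 2 * sigmaSU2 ‖vecToField H v x‖)

/-- **J2 `OrbitMapContraction` (M; owner w2).**  Quantitative closeness of `DΨ_V(v)` to the base operator `F_V = fpOperator H V` on a sup-box:
for `V` with links within `r₀²` of the identity (`C·r₀·H² ≤ 1`, so `F_V` is invertible with `‖F_V⁻¹‖₂ ≤ 8H²` by w4's floors + 4c-E) and
`‖A_x‖ ≤ a ≤ 1` for all `x`: `‖(1 − F_V⁻¹·DΨ_V(v)) w‖₂ ≤ C·H²·a·‖w‖₂`.  Route: `DΨ_V(v) = F(V^{pauliGauge A})·⊕_x jac(−iA_x)` (J1's structure),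
the two-configuration Lipschitz bound `‖F(W) − F(W')‖₂→₂ ≤ 84·max_e ‖W_e − W'_e‖` (4c-E's proof with `1 ↦ W'`; `F` is ℝ-linear in the links),
`‖(V^{pauliGauge A})_e − V_e‖ ≤ 4‖A‖_∞`, `‖jac(iA) − 1‖ ≤ e^{2‖A‖} − 1`, `‖F(W)‖₂→₂ ≤ C`. -/
def OrbitMapContraction : Prop :=
  ∃ C : ℝ, 0 < C ∧ ∀ H : ℕ, 1 ≤ H → ∀ r₀ a : ℝ, 0 ≤ r₀ → 0 ≤ a → a ≤ 1 → C * r₀ * (H : ℝ) ^ 2 ≤ 1 →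
    ∀ V : LGConfig 4 SU2, (∀ e ∈ boxEdges 4 (2 * H + 1), linkDefect V e ≤ r₀ ^ 2) →
      IsUnit (fpOperator H V).det ∧
      ∀ v : ↥(interiorSites H) × Fin 3 → ℝ, (∀ x, ‖vecToField H v x‖ ≤ a) →
        ∀ w : ↥(interiorSites H) × Fin 3 → ℝ,
          (w - (fpOperator H V)⁻¹ *ᵥ (fderiv ℝ (orbitMapFlat H V) v w)) ⬝ᵥ
              (w - (fpOperator H V)⁻¹ *ᵥ (fderiv ℝ (orbitMapFlat H V) v w)) ≤
            (C * (H : ℝ) ^ 2 * a) ^ 2 * (w ⬝ᵥ w)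

/-- **J4 `OrbitMapBulkSurj` (M; owner w4).**  Surjectivity of the orbit map from a small sup-box onto an ℓ²-ball: for `V` Landau (so
`Ψ_V(0) = 0`, ✓`landauPhi_eq_zero_iff`) with links within `r₀²`, and `a, ρ ≥ 0` with `C·(r₀ + a)·H² ≤ 1`, `C·H⁴·a ≤ 1`,
`C·(1 + log H)²·ρ ≤ a`: every `c` with `|c|₂ ≤ ρ` is `Ψ_V(v)` for some `v` with all `‖(♭⁻¹v)_x‖ ≤ a`.  Route: Banach fixed point
(`ContractingWith.fixedPoint`) of `Γ_c(v) = v − F_V⁻¹(Ψ_V(v) − c)` on the closed sup-box (complete): ℓ²-Lipschitz constant `C·H²·a < 1` by J2 +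
convexity (`Convex.lipschitzOnWith_of_nnnorm_hasFDerivWithin_le`); self-map since `‖Γ_c(v)_x‖ ≤ |Γ_c(v) − Γ_c(0)|₂ + ‖(F_V⁻¹c)_x‖ ≤
C H² a·|v|₂ + (max row ℓ²-norm of F_V⁻¹)·ρ ≤ 4C H⁴ a² + C'(1+log H)² ρ ≤ a` (rows: ✓4i-a `dirichletGreenFrobeniusRow` + ✓4v `PerturbedInverseRows`). -/
def OrbitMapBulkSurj : Prop :=
  ∃ C : ℝ, 0 < C ∧ ∀ H : ℕ, 1 ≤ H → ∀ r₀ a ρ : ℝ, 0 ≤ r₀ → 0 ≤ a → 0 ≤ ρ →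
    C * (r₀ + a) * (H : ℝ) ^ 2 ≤ 1 → C * (H : ℝ) ^ 4 * a ≤ 1 → C * (1 + Real.log H) ^ 2 * ρ ≤ a →
    ∀ V : LGConfig 4 SU2, InLandauGauge H V → (∀ e ∈ boxEdges 4 (2 * H + 1), linkDefect V e ≤ r₀ ^ 2) →
      ∀ c : ↥(interiorSites H) × Fin 3 → ℝ, c ⬝ᵥ c ≤ ρ ^ 2 →
        ∃ v : ↥(interiorSites H) × Fin 3 → ℝ, (∀ x, ‖vecToField H v x‖ ≤ a) ∧ orbitMapFlat H V v = c

/-! ## Sanity (builder's addition; everything above is byte-for-byte `TaskS5Laplace.lean`) -/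

/-- `0 ≤ jacWeight`. -/
theorem jacWeight_nonneg (β : ℝ) (H : ℕ) (r : ℝ) (W : LGConfig 4 SU2) : 0 ≤ jacWeight β H r W :=
  mul_nonneg (fpWeight_nonneg β H r W) (abs_nonneg _)

/-! ## Appended (append-only): the AMENDED target of `Cruxes/BoxWindowHighSU2213/TaskS5LaplaceR.lean` (planner ym-idea-2 g18, commit 7c567d974425) -/

/-- **T-S5.4J TARGET, amended (A)** — `OrbitNormaliserJacobian` with the constant-free radius gap `r₀ + 1/(H⁴(1+log β)²) ≤ r`.
For `β` in the window `C·H¹²(1+log β)⁸ ≤ β`, a Landau configuration `V` with links `≤ r₀²` (`C·r₀·H² ≤ 1`) and a cutoff radius `r` with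
`r₀ + 1/(H⁴(1+log β)²) ≤ r`, `C·r·H ≤ 1`: the orbit integral of the Jacobian-weighted insertion is `Z₀·(1 + O(e^{−cH⁴}))`. -/
def OrbitNormaliserJacobianR : Prop :=
  ∃ C c : ℝ, 0 < C ∧ 0 < c ∧ ∀ H : ℕ, 1 ≤ H → ∀ β r₀ r : ℝ, 2 ≤ β →
    C * (H : ℝ) ^ 12 * (1 + Real.log β) ^ 8 ≤ β →
    0 ≤ r₀ → C * r₀ * (H : ℝ) ^ 2 ≤ 1 →
    r₀ + 1 / ((H : ℝ) ^ 4 * (1 + Real.log β) ^ 2) ≤ r → C * r * H ≤ 1 →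
    ∀ V : LGConfig 4 SU2, InLandauGauge H V → (∀ e ∈ boxEdges 4 (2 * H + 1), linkDefect V e ≤ r₀ ^ 2) →
      |orbitAverage H (jacWeight β H r) V / laplaceZ0 β H - 1| ≤ Real.exp (-(c * (H : ℝ) ^ 4))

end Summit.QuantumFields.YangMills.Theorems.AllWindowsColdBoxBoxHighLine

end
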